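import Summits.CriticalPhenomena.SAWScalingLimit.Theorems.FKGToTraversalBound.Negative.DeepStartNotPresentable
import Summits.CriticalPhenomena.SAWScalingLimit.Theorems.SAWLeftRightFKGFKGToTraversalBoundSlitNecklaceDefs
import Summits.CriticalPhenomena.SAWScalingLimit.Theorems.SAWLeftRightFKGFKGToTraversalBoundEventualShellReduction
import Summits.CriticalPhenomena.SAWScalingLimit.Theorems.SAWLeftRightFKGFKGToTraversalBoundHungPresentation
import Summits.CriticalPhenomena.SAWScalingLimit.Theorems.SAWLeftRightFKGFKGToTraversalBoundGermTightBdry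
import Summits.CriticalPhenomena.SAWScalingLimit.Theorems.SAWLeftRightFKGFKGToTraversalBoundSlitNecklacePieces
import Summits.CriticalPhenomena.SAWScalingLimit.Theorems.SAWLeftRightFKGFKGToTraversalBoundNecklaceBookkeeping
import Summits.CriticalPhenomena.SAWScalingLimit.Theorems.SAWLeftRightFKGFKGToTraversalBoundSlitNecklaceFarTip
import Summits.CriticalPhenomena.SAWScalingLimit.Theorems.SAWLeftRightFKGFKGToTraversalBoundSlitNecklaceFarTipU
import Summits.CriticalPhenomena.SAWScalingLimit.Theorems.SAWLeftRightFKGFKGToTraversalBoundSlotLaw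
import Summits.CriticalPhenomena.SAWScalingLimit.Theorems.SAWLeftRightFKGFKGToTraversalBoundNecklaceAssemblyFar
import Summits.CriticalPhenomena.SAWScalingLimit.Theorems.SAWLeftRightFKGFKGToTraversalBoundWitnessFinal
import Summits.CriticalPhenomena.SAWScalingLimit.Theorems.SAWLeftRightFKGFKGToTraversalBoundBBBudget
import Summits.CriticalPhenomena.SAWScalingLimit.Theorems.SAWLeftRightFKGFKGToTraversalBoundSlitNecklaceTame
import Summits.CriticalPhenomena.SAWScalingLimit.Theorems.SAWLeftRightFKGFKGToTraversalBoundSplitWild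
import Summits.CriticalPhenomena.SAWScalingLimit.Theorems.SAWLeftRightFKGFKGToTraversalBoundGermTightShallow
import Summits.CriticalPhenomena.SAWScalingLimit.Theorems.SAWLeftRightFKGFKGToTraversalBoundTameRect
import Summits.CriticalPhenomena.SAWScalingLimit.Theses.SAWTotalPositivity

/-!
# Line `slit-necklace` — skeleton for crux `FKGToTraversalBound` (stmt-CriticalPhenomena-1878)

Crux (route `SAWLeftRightFKG`, rank 3): `FKGToTraversalBound := LeftRightFKG → SAWTraversalBound` (`Iff.rfl`,
`Negative.iff_imp`).  By `Negative`/Disproof F1 (`mono_hyp`) every proof is `PA → P` and `P → (H1)`; no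
`_false_without_` certificate exists (the only dropped-hypothesis variant is (H1) itself).

Idea (card `Cruxes/FKGToTraversalBound/Ideas/slit-necklace.md`, triage r2-1/r2-2: pass ×2): every line of rounds 1
died at ONE stub — per-shell tightness on the DEEP-ENDPOINT fragment of `IsEndpointApprox`, where no EXPLORATION
(stopping-time conditioning) of the chord ever carries an instance of `LeftRightFKG` (`Negative.noFloatingHoles`,
`Negative.not_presentable_of_enclosed`, `Negative.deepStart_eventually_not_presentable`).  The necklace is a STATIC
disintegration instead: hang the chord `γ` on a lattice slit `π` from the boundary layer to the deep endpoint, cut at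
the LAST visit `L` to `π`; (T) given the necklace `ω = γ[0,L]`, the tail `γ[L,end]` IS the critical chord of the hung
carrier `Ω_δ ∖ π ∖ ω`, an r2 (0-defect) carrier with both endpoints trace-adjacent; (B) given everything else, each
bead (maximal run of `ω` off `π`) IS again such a chord.  Hole-freeness puts the tail outside every bead loop; beads
force one another only by nesting.  What is left is a MULTIPLICITY question at the two marked points: how many pieces
reach macroscopic distance — controlled by ONE rate-free bulk input per endpoint (`GermTight`, triage r2-1
`DeepNoReturn` = r2-2 `GermExcursionMean`, with inner radius SHRINKING like the depth), NOT by the card's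
`BulkArmsGeometric`/`RoundTripGeometric` (dropped: triage showed them mis-aimed and unnecessary).

Typing found a SECOND statement-level residue, disjoint from the deep-endpoint one: Smirnov's discretisation
`discreteDomainGraph D δ` of a Jordan domain is an r2 graph only up to a set `S` of DEFECT sites (missing mesh edges
under thin exterior bumps — present at a sparse infinite set of meshes already for SMOOTH non-convex `D` with an
axis-parallel tangent at an exterior-convex boundary point —, enclosed exterior sites near reflex corners).  For TAME domains (`EventuallyTame`: eventually `#S ≤ N₀`) the necklace absorbs `S` into
its spine at no cost (≤ `N₀ + 1` extra pieces); WILD domains (zero exterior angles, fractal boundaries: unbounded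
defect sets at arbitrarily small meshes) are isolated in `stub_wildDomains` — not this line's mechanism, recorded so
that the composition is honest (recommended planner action in the line card).

The SEVEN registered stubs and the sorry-free composition `FKGToTraversalBound_of`:
* `stub_eventualShellReduction` (M, provable now) — (H1) is needed one fixed shell of modulus `≥ 2` at a time, only
  eventually in `δ` (ideator 5's `EventualShellReduction`: deterministic count `k ≤ 2|γ|` for `δ ≥ δ₁`, `law ≤ 1` for
  thin shells, `K = 8`, `λ = 3`).  DEF-FREE.
* `stub_hungPresentation` (L, provable now) — every HUNG carrier is r2: for a boundary walk `C`, a finite set `K` of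
  sites each joined to `C` through `K ∪ C.support`, and `b ∉ K`, some closed walk `C' ⊇ C.support ∪ K` presents
  `Keep(b, K)` = the sites joined to `b` off `K` (graph equality; sealed pockets, dropped lobes and the
  largest-component convention swept onto the trace).  Generalises the LANDED `stub_slitPresentation` (p102570, prefix
  path) verbatim in shape; it is the r2 half of (T) and (B) (the weight half is the landed `weight_prefix` /
  `weight_restrict`, p85820).  DEF-FREE.
* `stub_engine` (XL, open) — the R1 ENGINE as a black box: `LeftRightFKG → CriticalBubbleBound → UniformShellTight`,
  uniform per-shell tightness of traversal counts over the whole r2 family with a STATIC forcing allowance.  The bubble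
  hypothesis is explicit (lead c1 F-B `EngineNeedsBubble`, triage N-r2-1/Q2: a quenched engine is ≥ bubble-grade); the
  sibling round-2 line gates≈pushdown owns its interior (excision of gated rooms from `G_{x_c}(0,e₁)`, wide doors by
  PA, lattice KS iteration with the 20 landed helper files of the dead line).
* `stub_criticalBubble` — `SAWTotalPositivity.CriticalBubbleBound`, item stmt-CriticalPhenomena-7117 VERBATIM (shared;
  open since Madras–Slade 1993): the machine-readable form of "blocked-on 7117".
* `stub_slitNecklace` (XL, THE LEVER; `stub_necklace` before reshape r1) — `HungPresentation → UniformShellTight → EventuallyTame D → GermTight(a) →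
  GermTight(b) → EventualShellTight` for every `IsEndpointApprox`.
* `stub_germTight` (open, conjectural, rate-free; candidate shared item) — the traversal count of the endpoint-centred
  shell `D(a_δ; 2·dist(a_δ,∂D) + 4δ, r)` (inner radius SHRINKING with the depth, outer radius fixed) is tight
  eventually in `δ`, at both marked points.  DEF-FREE.  Deterministically bounded on the R1 class (lattice-scale inner
  ball), so the line restricted to `BdryApprox` needs only stubs 1–5.
* `stub_wildDomains` (residue, statement-level) — the same conclusion for NOT eventually tame Jordan domains.

`sorry` occurs only in the `stub_*` theorems; `FKGToTraversalBound_of` takes the seven statements as hypotheses and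
concludes the crux BY NAME; `FKGToTraversalBound_proof` instantiates it with the stubs.

RESHAPE r1 (lead prover-line-stmt-CriticalPhenomena-1878-c4-0, 2026-08-16): the vocabulary now lives in the LANDED Theorems
file `Theorems/SAWLeftRightFKGFKGToTraversalBoundSlitNecklaceDefs.lean` (p127344, namespace
`…Theorems.FKGToTraversalBound.SlitNecklace`, opened below) so that stub proofs state the registered signatures against the
same constants; `stub_necklace` is RENAMED `stub_slitNecklace` (the sibling line `gates-by-bubble-doors-by-fkg`, led in
parallel by lead a3, has a registered stub `stub_necklace` with a different signature); statements unchanged.  Stubs are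
registered ADDITIVELY (`workitem stub-add`) while a3's skeleton is live on the item.

RESHAPE r2 (lead c4, after wave 1, 2026-08-16): STUBS 1–2 LANDED (`SlitNecklace.stub_eventualShellReduction` p127535,
`SlitNecklace.stub_hungPresentation` p127603 — imported, their `sorry`s are gone), plus the R1-class case of STUB 6
(`SlitNecklace.germTight_of_bdryApprox` p128312: on `BdryApprox` the germ input is deterministic).  The engine currency is
REPAIRED: `UniformShellTight` (same-shell static witness) is conjecturally junk-false over the r2 family (tip-squeeze meanders,
wave-1 adjudication of `stub_engine`, `work/stubs/stub_engine.md`), so stubs 3, 5, 7 now speak the ROBUST currency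
`UniformSubshellTight` (witness on the concentric sub-shell with margins `(R − ρ)/4`, `SlitNecklaceDefs` reshape r2,
`uniformSubshellTight_of_uniformShellTight`).  Five `sorry`s remain: `stub_engine`, `stub_criticalBubble`, `stub_slitNecklace`,
`stub_germTight`, `stub_wildDomains`; `FKGToTraversalBound_of_R1` records that on the R1 class (`BdryApprox`) only
`stub_engine`, `stub_criticalBubble`, `stub_slitNecklace` (and tameness) are consumed.

RESHAPE r3 (lead c4, chart `Lines/slit-necklace-chart-r2.md`): the lever is SPLIT.  `stub_slitNecklace` (registered signature kept)
is now GLUE over three registered stubs: `stub_necklaceBookkeeping : NecklaceBookkeeping` (deterministic, provable now),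
`stub_necklaceWitness : NecklaceWitness` (deterministic planar topology of hugging routes — the line's own hard lemma) and
`stub_necklaceAssembly` (the probabilistic assembly: disintegration per slot + dependency-depth induction with the sub-shell
pigeonhole `hasTraversals_subshell_pigeonhole` p129366 and the radial split avoiding the marked points).  Vocabulary (spine indices,
pieces, index windows, far pieces) and the two Props: `Theorems/SAWLeftRightFKGFKGToTraversalBoundSlitNecklacePieces.lean`.
Helpers registered outside the skeleton: `hasTraversals_radial_part`, `exists_centre_net`, `stub_necklaceSpine`.
After wave 2 (same cycle) STUB 5a and all three helpers LANDED; six `sorry`s remain: `stub_engine`, `stub_criticalBubble`,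
`stub_necklaceWitness`, `stub_necklaceAssembly`, `stub_germTight`, `stub_wildDomains`.

RESHAPE r4 (lead prover-line-stmt-CriticalPhenomena-1878-c5-0, chart `Lines/slit-necklace-chart-r4.md`): finding F1 — the r3 assembly's
union bound over whole-piece SLOTS is charged once per piece between consecutive far pieces, and near a deep endpoint the chord revisits
the blob `≍ (ι/δ)^{1/3}` times, so chart r2 step P2 is empty exactly on the deep fragment.  Repair: cut the `J`-th far-reaching piece at
its FIRST and LAST far indices (`IsFarTipPiece`, vocabulary `Theorems/SAWLeftRightFKGFKGToTraversalBoundSlitNecklaceFarTip.lean`, p132289):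
the slot becomes canonical (disjoint decomposition, total law `≤ 1`), the middle given the exterior is the chord of the doubly-slit hung
carrier between the two far tips (bead identity p126690 + hung presentation p127603), and the engine applies UNCONDITIONALLY with a
far-tip witness as static allowance.  The lever is now glue over THREE registered stubs: `stub_slotLaw : SlotLaw` (probabilistic core,
provable now), `stub_necklaceWitnessFar : NecklaceWitnessFar` (deterministic planar topology, the hard lemma, witness between the far
tips with an `abab` run bound) and `stub_necklaceAssemblyFar` (cascade + selection + union bound, provable now modulo the Props);
`stub_necklaceBookkeeping` (p130309) is consumed unchanged.  The r3 stubs `stub_necklaceWitness` / `stub_necklaceAssembly` are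
SUPERSEDED (left registered, not pursued).  Seven `sorry`s: `stub_engine`, `stub_criticalBubble`, `stub_slotLaw`,
`stub_necklaceWitnessFar`, `stub_necklaceAssemblyFar`, `stub_germTight`, `stub_wildDomains`.

RESHAPE r4.1 (lead c5, after wave 1): `stub_slotLaw` LANDED (p134383, `Theorems/SAWLeftRightFKGFKGToTraversalBoundSlotLaw.lean`, with
helper files p133358 SlotCombinatorics, p133431 SlotBead, p133835 SlotEngine).  The assembly worker certified two defects of the r4
typing and repaired them: (i) `SlotLaw` is itself `HungPresentation → UniformSubshellTight → …`, so the assembly must receive the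
engine currency to use it (the r4 glue `stub_necklaceAssemblyFar (stub_slotLaw h₁ h₂)` was ill-typed); (ii) `NecklaceWitnessFar`
quantifies its rank AFTER the shell, while the cascade descent needs ONE rank for all shells of the finite cascade family
(per-shell ranks admit level-alternating ranks with no stopping point).  New vocabulary `NecklaceWitnessFarU` (rank-uniform form,
`Theorems/…SlitNecklaceFarTipU.lean`, p137250, with glue `necklaceWitnessFar_of_uniform`), new registered stubs
`stub_necklaceWitnessFarU : NecklaceWitnessFarU` (the open hard lemma, held by the lead) and `stub_necklaceAssemblyFarU :
SlotLaw → NecklaceBookkeeping → NecklaceWitnessFarU → UniformSubshellTight → …` — LANDED (`Theorems/…NecklaceAssemblyFar.lean` over the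
seven part files p134980 rankDescent, p135063 walk-level window pigeonhole, p135280 cascadeSelection, p135403 tamePresentation_attached
(TamePresentation's defect set is NOT attached in general: normalised to `S'`, `#S' ≤ 5 #S`), p135547 badEvent bound, p135601 swallowed
case, p135632 blobs).  `sorry`s left: `stub_engine`, `stub_criticalBubble`, `stub_necklaceWitnessFarU`, `stub_germTight`,
`stub_wildDomains` — i.e. the line is CLOSED MODULO (engine ∧ 7117 ∧ the planar witness lemma ∧ GermTight ∧ wild residue).
RESHAPE r4.2 (2026-08-17): the planar witness `NecklaceWitnessFarU` is LANDED MODULO THE BOUNDARY BUDGET —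
`necklaceWitnessFarU_of_boundaryBudget : BoundaryBudget → NecklaceWitnessFarU` (p154966, `Theorems/…WitnessFinal.lean`, over 30 helper
files: outline tour/cycle/arc/abab/shared/side/period (p139506 p140553 p142681 p142763 p143719 p142784 p144722), free carrier p142802,
window reparam/tighten/shadow (p142931 p143640 p143732), Davenport–Schinzel p142626, rank descent p143657, obstacle one-sided/straight/turn/
triple + block monotonicity (p145084 p145501 p145045 p145080 p145799), glue cfg p146194, setup p149380, route p149650, rest class p148544,
child side p149052, block-monotone transfer p151053, classes p152913, pure-far p152663, facing transfer p152688, accounting p154435,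
final p154966).  `stub_necklaceWitnessFarU` is now PROVED from the new registered stub `stub_boundaryBudget : BoundaryBudget`
(`Theorems/…BoundaryBudget.lean`, p146055: along the wall-follower tour of a carrier component, boundary-FACING windows across a genuine
shell are bounded by a constant of the domain and the shell, eventually in δ — the discrete shadow of `Curve.exists_not_hasTraversals`
for ∂D).  `sorry`s left: `stub_engine`, `stub_criticalBubble`, `stub_boundaryBudget`, `stub_germTight`, `stub_wildDomains`.
RESHAPE r4.3 (2026-08-17): `stub_boundaryBudget` LANDED (p159748, `Theorems/…BBBudget.lean` + 13 helper files) — the planar witness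
`NecklaceWitnessFarU` is an unconditional theorem.  `sorry`s left: `stub_engine`, `stub_criticalBubble`, `stub_germTight`, `stub_wildDomains`.
RESHAPE r5 (lead prover-line-stmt-CriticalPhenomena-1878-c6-0, 2026-08-17): stub set UNCHANGED (the four remaining stubs are the
strategist's route children, each crux-sized); landed around them: (i) the SHARPER split glue `Split.FKGToTraversalBound_of_subsWild`
(bubble → engine → germ → WILD residue → crux) and `Split.necklaceReduction_of_wildResidue` (child 4 = the theorem
`necklaceReduction_tame` + `stub_wildDomains`), `Theorems/…SplitWild.lean` p162103; (ii) the germ child beyond R1: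
`germTight_of_shallow` / `germTight_pair_of_shallow` (depth `O(δ)` approximations, `Theorems/…GermTightShallow.lean` p162425);
(iii) the TAME class is inhabited and checkable: `tamePresentation_of_holeFree[_conn]` (a hole-free induced discretisation is an
r2 carrier with no defect — rectangle boundary walk + sweep, `Theorems/…TamePresentation.lean` p163151) and
`eventuallyTame_of_carrier_eq_rect` / `exists_dobrushinDomain_rect_eventuallyTame` (every axis-parallel rectangle is tame at every
mesh, `Theorems/…TameRect.lean` p165207), `tamePresentation_ball` / `eventuallyTame_unitDisc` (`Theorems/…TameDisc.lean` p166007) and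
`tamePresentation_of_convex` / `eventuallyTame_of_convex` (EVERY convex Dobrushin domain, every mesh, `Theorems/…TameConvex.lean` p166328);
(iv) FINDING F-G — the germ child is NECESSARY: `germTight_of_eventualShellTight` (`Theorems/…GermTightNecessary.lean` p166051:
every germ-shell traversal contains a traversal of a fixed shell about the marked point) and `eventualShellTight_of_h1At` — the CONVERSE
of stub 1, so `EventualShellTight ⟺ H1At` under `IsEndpointApprox` (`Theorems/…ShellTightOfH1.lean` p166534, circle-cover pigeonhole with
λ > 1); hence `stub_germTight` ⟸ `SAWTraversalBound` (stmt-1880) and, GIVEN the engine, on tame domains `H1At ⟺ GermTight a ∧ GermTight b`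
(`Theorems/…GermTightIff.lean`).  Consequently (H1) is KERNEL-CHECKED MODULO ENGINE + BUBBLE on {eventually tame D} × {shallow
approximations} (`Split.h1At_of_eventuallyTame_of_shallow`, `Theorems/…TameInstances.lean` p165463), a class certified to contain every
convex domain with every O(δ)-deep approximation and strictly larger than R1 even on the disc
(`exists_isEndpointApprox_shallow_not_bdryApprox`, `Theorems/…ShallowCert.lean` p167284).  The four `sorry`s are unchanged and each is
crux-sized: `stub_engine` (the kernel), `stub_criticalBubble` (stmt-7117), `stub_germTight` (necessary; open off the shallow class),
`stub_wildDomains` (statement-level).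
-/

noncomputable section

open MeasureTheory Filter Topology Set Metric
open scoped NNReal ENNReal
open Literature.Probability.LatticeModels
open Literature.Probability.RandomPlanarGeometry
open Literature.Probability.RandomPlanarGeometry.SAW
open Summit.CriticalPhenomena.SAWScalingLimit.Theses.SAWLeftRightFKG
open Summit.CriticalPhenomena.SAWScalingLimit.Theses.SAWTotalPositivity (CriticalBubbleBound)
open Summit.CriticalPhenomena.SAWScalingLimit.Theorems.FKGToTraversalBound.Negative (dom lrLE H1At BdryApprox)
open Summit.CriticalPhenomena.SAWScalingLimit.Theorems.FKGToTraversalBound.SlitNecklace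

namespace Summit.CriticalPhenomena.SAWScalingLimit.Cruxes.FKGToTraversalBound.SlitNecklace

/-! ## Stubs (registered; `sorry` only here) -/

/-! STUBS 1–2 are LANDED and imported: `stub_eventualShellReduction` (p127535,
`Theorems/SAWLeftRightFKGFKGToTraversalBoundEventualShellReduction.lean`) and `stub_hungPresentation` (p127603,
`Theorems/SAWLeftRightFKGFKGToTraversalBoundHungPresentation.lean`), both in the opened namespace
`…Theorems.FKGToTraversalBound.SlitNecklace`, with the registered signatures verbatim. -/

/-- STUB 3 (XL; open — the R1 ENGINE, consumed as a black box; NOT this line's mechanism) — **left–right PA plus the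
critical bubble give uniform shell tightness over the r2 family.**  Interior owned by the sibling round-2 line
(gates-by-bubble-doors-by-fkg ≈ pushdown-polygon-bubble, triage r2-1/r2-2): (i) ε-source — an unforced crossing of an
annulus of modulus `M` in an admissible carrier costs `≤ 1 - η` uniformly: gated rooms (mouth `≤ w₀`) discharged by
EXCISION from `G_{x_c}(0,e₁) < ∞` (`CriticalBubbleBound`, with the dead-end proviso and the mouth-cluster / lining
lemmas of the r2-2 repair), extremal pockets by the polygon series, WIDE doors by PA (the RSW seed — the one place
`LeftRightFKG` is meant to work; BN-C: no card yet manufactures ε from PA); (ii) the Kemppainen–Smirnov iteration ON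
THE LATTICE (KS17 arXiv:1212.6215 Prop. 3.5 / Lemma 3.6, index = static allowance `n₀` at time zero, `±`jumps amortised —
lead c2's serpentine caveat), importing the dead line's landed plumbing verbatim: `stub_treeTailBound` p99860,
`stub_sweep` p100023, `stub_slitPresentation` p102570, domain Markov p85820, traversal dictionary p115507/p116011, RW
collar kernel p109398–p114323 (mod `KemppainenSmirnov2017_rwDeadEndBound`, def p113449).  Why the bubble is a
HYPOTHESIS: every uniform-in-the-carrier engine accepts the neck-and-room family, hence implies `CeilingBubbleBound`
(lead c1 F-B, `Cruxes/…/EngineNeedsBubble.lean`; folded/sheathed families push the grade to S/G, BN-4c, BN5-7), which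
is implied by stmt-7117 (`ceilingBubble_of_criticalBubble`).  A PA-free proof also closes the stub (`mono_hyp`). -/
theorem stub_engine : LeftRightFKG → CriticalBubbleBound → UniformSubshellTight := by
  sorry

/-- STUB 4 (open problem; SHARED ITEM stmt-CriticalPhenomena-7117 verbatim — `SAWTotalPositivity.CriticalBubbleBound`,
rank-4 crux of route `SAWTotalPositivity`) — **finiteness of the critical bubble in `d = 2`**: `Z_Ω(u,v) ≤ C` for all
bounded `Ω`, `δ > 0`, `u ∼ v` (⟺ `G_{x_c}(0,e₁) < ∞` on `ℤ²`; Madras–Slade 1993 p. 22: open; Hammond 2018 Thm 1.3: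
`p_n ≤ n^{-3/2+o(1)} μ^n` on a density-one set only).  Registered here so that "this line is blocked on 7117" is
machine-readable: any proof of stmt-7117 closes this stub by name. -/
theorem stub_criticalBubble : CriticalBubbleBound := by
  sorry

/-! STUB 5a `stub_necklaceBookkeeping : NecklaceBookkeeping` is LANDED (p130309,
`Theorems/SAWLeftRightFKGFKGToTraversalBoundNecklaceBookkeeping.lean`) and imported; so are the r3 helpers
`hasTraversals_radial_part` (p130091), `exists_centre_net` (p130039), `stub_necklaceSpine` (p130753),
`hasSepWindows_window_iff` (p130875) and `hasTraversals_subshell_pigeonhole` (p129366). -/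

/-! STUB 5b `stub_slotLaw : SlotLaw` is LANDED (p134383, `Theorems/SAWLeftRightFKGFKGToTraversalBoundSlotLaw.lean`) and imported;
STUB 5d `stub_necklaceAssemblyFarU` is LANDED (`Theorems/SAWLeftRightFKGFKGToTraversalBoundNecklaceAssemblyFar.lean`) and imported. -/

/-! STUB 5e `stub_boundaryBudget : BoundaryBudget` (reshape r4.2) is LANDED (p159748,
`Theorems/SAWLeftRightFKGFKGToTraversalBoundBBBudget.lean`, over BBBasic p156956, BBRound p156949, BBRefineStep/Tour/Conn
p157364/p157976/p157377, BBFaceLocal/FaceChain p157322/p157997, BBFourPointBody/Facts/Connectors/Core/FourPoint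
p157370/p158091/p158355/p158765/p159309, BBCyclic p157160, BBBudgetPrep p157308) and imported: feet of facing edges on ∂D,
the four-point separation lemma (exterior connectors in the Schoenflies round model + fine body refinement + face-chain
discretisation + `btour_abab`), cyclic monotonicity, thinning to distinct feet, and `Curve.exists_not_hasTraversals` for the
curve `t ↦ H(e^{2πit})`.  Hence `stub_necklaceWitnessFarU` below is now an UNCONDITIONAL theorem (reshape r4.3, 2026-08-17). -/

/-! STUB 5c `stub_necklaceWitnessFarU : NecklaceWitnessFarU` (the line's own hard lemma, the planar far-tip witness) and
STUB 5 `stub_slitNecklace : HungPresentation → UniformSubshellTight → ∀ D a b, IsEndpointApprox D a b → EventuallyTame D →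
GermTight D a b a → GermTight D a b b → EventualShellTight D a b` (the slit necklace, glue) are LANDED
(`Theorems/SAWLeftRightFKGFKGToTraversalBoundSlitNecklaceTame.lean`, p160250, with the riders `necklaceWitnessFar_holds` and
`necklaceReduction_tame` = the TAME case of the route child `NecklaceReduction`) and imported from the opened namespace. -/

/-- STUB 6 (open, conjectural, RATE-FREE; the line's one bulk input, at the two marked points only; DEF-FREE = the
body of `GermTight D a b a ∧ GermTight D a b b`; candidate SHARED statement item for every tightness route) — **germ
tightness**: for every `r > 0` the number of separate traversals of `D(δa_δ; 2 dist(δa_δ, ℂ∖D) + 4δ, r)` (and the same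
at `b`) is tight eventually in `δ`.  Why plausible: it asserts only that the chord returns from macroscopic distance to
within twice-the-depth of its own endpoint tightly often — transience of the (conjectural) scaling limit away from its
root; on `BdryApprox` it is deterministic (`O(1)` sites in the inner ball).  Why it might fail: a both-deep
approximation in a domain pinched at the marked point could force returns — but forced returns enter through the
domain's own `δ`-uniform crossing number of `D(a; ι, r)`, bounded for a Jordan domain.  Cheapest falsifier: exact
enumeration of the return count to `B(a_δ, 2·depth)` on one-deep 6×6 / 7×6 box carriers at `x_c` (ideator 4's
`exp/necklace.py` regime: `P(#nontrivial beads ≥ 2) ≤ 5.4e-4`): a return-count tail FATTENING with the box kills it.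
NOT implied by (H1) (inner radius shrinks with `δ`; (H1)'s threshold may diverge there); independent of PA. -/
theorem stub_germTight :
    ∀ (D : DobrushinDomain) (a b : ℝ → Site 2), IsEndpointApprox D a b →
      (∀ r : ℝ, 0 < r → ∀ ε : ℝ, 0 < ε → ∃ n : ℕ, ∀ᶠ δ in 𝓝[>] (0 : ℝ),
        law D.carrier δ (a δ) (b δ)
            {γ | (⟨γ.walk.toCurve (meshPoint δ)⟩ : Curve ℂ).HasTraversals n (meshPoint δ (a δ))
              (2 * infDist (meshPoint δ (a δ)) D.carrierᶜ + 4 * δ) r} ≤ ENNReal.ofReal ε) ∧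
      (∀ r : ℝ, 0 < r → ∀ ε : ℝ, 0 < ε → ∃ n : ℕ, ∀ᶠ δ in 𝓝[>] (0 : ℝ),
        law D.carrier δ (a δ) (b δ)
            {γ | (⟨γ.walk.toCurve (meshPoint δ)⟩ : Curve ℂ).HasTraversals n (meshPoint δ (b δ))
              (2 * infDist (meshPoint δ (b δ)) D.carrierᶜ + 4 * δ) r} ≤ ENNReal.ofReal ε) := by
  sorry

/-- STUB 7 (residue; NOT this line's mechanism; statement-level) — **wild Jordan domains**: per-shell eventual
tightness for approximations in domains that are NOT eventually tame (the defect set of Smirnov's discretisation is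
unbounded at arbitrarily small meshes: zero exterior angles / inward cusps, boundaries oscillating at every scale).
There floating lattice defects (exterior sites enclosed by domain sites; dropped mesh edges far from any non-domain
site) recur at all scales; each is presentable only after slitting, and the number of pieces hung on defect slits has
no controlled multiplicity (union bound `≍ (ℓ/δ)(δ/r)^Δ` diverges for the engine's `Δ < 1`).  The engine and the
germ inputs are offered as hypotheses for any future argument.  Recommended planner action (line card): restate
`SAWTraversalBound` over eventually tame domains (all piecewise-`C¹` domains with non-zero angles) or file
`WildDomainTight` as its own item — the fragment is disjoint from R1 (`BdryApprox`) and from the deep-endpoint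
fragment, and it is shared by EVERY line of this crux and of the R1-crux `FKGToTraversalBoundBdry`. -/
theorem stub_wildDomains :
    UniformSubshellTight →
      ∀ (D : DobrushinDomain) (a b : ℝ → Site 2), IsEndpointApprox D a b → ¬ EventuallyTame D →
        GermTight D a b a → GermTight D a b b → EventualShellTight D a b := by
  sorry

/-! ## Composition (sorry-free) -/

/-- **`FKGToTraversalBound` from the seven stub statements** (hypotheses in registration order).  PA and the bubble
feed the engine (stubs 3–4); for each endpoint approximation the germ input (stub 6) and either the necklace (stub 5,
tame domains, with the hung presentation stub 2) or the wild residue (stub 7) give per-shell eventual tightness, and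
the eventual-shell reduction (stub 1) assembles (H1) = `H1At` (`Negative.traversalBound_iff_H1At`, `Iff.rfl`). -/
theorem FKGToTraversalBound_of
    (h₁ : ∀ (D : DobrushinDomain) (a b : ℝ → Site 2), IsEndpointApprox D a b →
      (∀ (x : ℂ) (ρ R : ℝ), 0 < ρ → 2 * ρ ≤ R → R ≤ 1 → ∀ ε : ℝ, 0 < ε → ∃ n : ℕ,
        ∀ᶠ δ in 𝓝[>] (0 : ℝ),
          law D.carrier δ (a δ) (b δ)
              {γ | (⟨γ.walk.toCurve (meshPoint δ)⟩ : Curve ℂ).HasTraversals n x ρ R} ≤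
            ENNReal.ofReal ε) →
      ∃ (k : ℂ → ℝ → ℝ → ℕ) (K lam δ₀ : ℝ), 0 ≤ K ∧ 2 < lam ∧ 0 < δ₀ ∧ ∀ δ ∈ Set.Ioc (0 : ℝ) δ₀,
        ∀ (x : ℂ) (ρ R : ℝ), δ ≤ ρ → ρ < R → R ≤ 1 →
          law D.carrier δ (a δ) (b δ)
              {γ | (⟨γ.walk.toCurve (meshPoint δ)⟩ : Curve ℂ).HasTraversals (k x ρ R) x ρ R} ≤
            ENNReal.ofReal (K * (ρ / R) ^ lam))
    (h₂ : HungPresentation)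
    (h₃ : LeftRightFKG → CriticalBubbleBound → UniformSubshellTight)
    (h₄ : CriticalBubbleBound)
    (h₅ : HungPresentation → UniformSubshellTight →
      ∀ (D : DobrushinDomain) (a b : ℝ → Site 2), IsEndpointApprox D a b → EventuallyTame D →
        GermTight D a b a → GermTight D a b b → EventualShellTight D a b)
    (h₆ : ∀ (D : DobrushinDomain) (a b : ℝ → Site 2), IsEndpointApprox D a b →
      GermTight D a b a ∧ GermTight D a b b)
    (h₇ : UniformSubshellTight →
      ∀ (D : DobrushinDomain) (a b : ℝ → Site 2), IsEndpointApprox D a b → ¬ EventuallyTame D →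
        GermTight D a b a → GermTight D a b b → EventualShellTight D a b) :
    FKGToTraversalBound := by
  intro hPA D a b hab
  have hE : UniformSubshellTight := h₃ hPA h₄
  have hT : EventualShellTight D a b := by
    by_cases hD : EventuallyTame D
    · exact h₅ h₂ hE D a b hab hD (h₆ D a b hab).1 (h₆ D a b hab).2
    · exact h₇ hE D a b hab hD (h₆ D a b hab).1 (h₆ D a b hab).2
  exact h₁ D a b hab hT

/-- The crux BY NAME from the registered stubs. -/
theorem FKGToTraversalBound_proof : FKGToTraversalBound :=
  FKGToTraversalBound_of stub_eventualShellReduction stub_hungPresentation stub_engine stub_criticalBubble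
    stub_slitNecklace stub_germTight stub_wildDomains

/-- **The R1-crux from three stubs** (sorry-free bookkeeping of reshape r2): on endpoint approximations that are
eventually lattice-boundary vertices (`Negative.BdryApprox`, repair R1 of the crux) and eventually tame domains, the germ
input is the LANDED `germTight_of_bdryApprox`, so (H1) there needs only the engine (with the bubble) and the necklace. -/
theorem h1At_of_bdryApprox_of_tame
    (h₃ : LeftRightFKG → CriticalBubbleBound → UniformSubshellTight) (h₄ : CriticalBubbleBound)
    (h₅ : HungPresentation → UniformSubshellTight →
      ∀ (D : DobrushinDomain) (a b : ℝ → Site 2), IsEndpointApprox D a b → EventuallyTame D →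
        GermTight D a b a → GermTight D a b b → EventualShellTight D a b)
    (hPA : LeftRightFKG) (D : DobrushinDomain) (a b : ℝ → Site 2) (hab : IsEndpointApprox D a b)
    (hbd : BdryApprox D a b) (hD : EventuallyTame D) : H1At D a b :=
  stub_eventualShellReduction D a b hab
    (h₅ stub_hungPresentation (h₃ hPA h₄) D a b hab hD (germTight_of_bdryApprox D a b hab hbd).1
      (germTight_of_bdryApprox D a b hab hbd).2)

/-! ## Negative checks (sorry-free): what the certified obstructions say about this stub set

* `Negative.exists_isEndpointApprox_not_bdryApprox` (R1Split, p82017): the deep fragment is inhabited — exactly where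
  `stub_germTight` has content and where `stub_necklace` does the work the dead lines' residue stubs could not.
* `Negative.deepStart_eventually_not_presentable` (p117623): no presentation WITH ENDPOINT ADJACENCY exists at a deep
  start; `TamePresentation` has NO endpoint clause (the necklace supplies adjacency piece by piece), so no stub of this
  line asserts what that theorem refutes.
* `Negative.noFloatingHoles` / `not_presentable_of_enclosed` (p74067): honoured by the ATTACHED hypothesis of
  `HungPresentation` (every removed site is joined to the trace through removed sites).
* F1 `Negative.iff_imp` / Disproof `mono_hyp`: the line is `PA → P → (H1)` with
  `P := UniformSubshellTight` (given the bubble); no `_false_without_` theorem exists for this crux. -/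

/-- The regime in which stubs 5–6 carry the crux beyond R1 is inhabited (certified, `Negative/R1Split`). -/
theorem deepFragment_inhabited :
    ∃ a b : ℝ → Site 2, IsEndpointApprox DobrushinDomain.unitDisc a b ∧
      ¬ BdryApprox DobrushinDomain.unitDisc a b :=
  Summit.CriticalPhenomena.SAWScalingLimit.Theorems.FKGToTraversalBound.Negative.exists_isEndpointApprox_not_bdryApprox

/-- … and there no presentation with endpoint adjacency exists at any small mesh (certified, `Negative/DeepStartNotPresentable`):
the tame presentation of this line deliberately carries no endpoint clause. -/
theorem deepStart_noEndpointPresentation :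
    ∃ a b : ℝ → Site 2, IsEndpointApprox DobrushinDomain.unitDisc a b ∧
      ∀ᶠ δ in 𝓝[>] (0 : ℝ),
        ¬ ∃ (c u' v' : Site 2) (C : (zdGraph 2).Walk c c), u' ∈ C.support ∧ v' ∈ C.support ∧
            (zdGraph 2).Adj (a δ) u' ∧ (zdGraph 2).Adj (b δ) v' ∧
            discreteDomainGraph DobrushinDomain.unitDisc.carrier δ = discreteDomainGraph (dom C δ) δ :=
  Summit.CriticalPhenomena.SAWScalingLimit.Theorems.FKGToTraversalBound.Negative.deepStart_eventually_not_presentable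

/-! ## Audit helpers (sorry-free): the line-local statements unfold to the registered def-free signatures -/

theorem eventualShellTight_iff (D : DobrushinDomain) (a b : ℝ → Site 2) :
    EventualShellTight D a b ↔
      ∀ (x : ℂ) (ρ R : ℝ), 0 < ρ → 2 * ρ ≤ R → R ≤ 1 → ∀ ε : ℝ, 0 < ε → ∃ n : ℕ,
        ∀ᶠ δ in 𝓝[>] (0 : ℝ),
          law D.carrier δ (a δ) (b δ)
              {γ | (⟨γ.walk.toCurve (meshPoint δ)⟩ : Curve ℂ).HasTraversals n x ρ R} ≤
            ENNReal.ofReal ε :=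
  Iff.rfl

theorem germTight_iff (D : DobrushinDomain) (a b e : ℝ → Site 2) :
    GermTight D a b e ↔
      ∀ r : ℝ, 0 < r → ∀ ε : ℝ, 0 < ε → ∃ n : ℕ, ∀ᶠ δ in 𝓝[>] (0 : ℝ),
        law D.carrier δ (a δ) (b δ)
            {γ | (⟨γ.walk.toCurve (meshPoint δ)⟩ : Curve ℂ).HasTraversals n (meshPoint δ (e δ))
              (2 * infDist (meshPoint δ (e δ)) D.carrierᶜ + 4 * δ) r} ≤ ENNReal.ofReal ε :=
  Iff.rfl

/-- (H1) for one approximation is `Negative.H1At` (definitional), so stub 1 is literally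
`EventualShellTight D a b → H1At D a b` under `IsEndpointApprox`. -/
theorem h1At_of_eventualShellTight (D : DobrushinDomain) (a b : ℝ → Site 2) (hab : IsEndpointApprox D a b)
    (h : EventualShellTight D a b) : H1At D a b :=
  stub_eventualShellReduction D a b hab h

/-- On the crux's own terms: the line proves `LeftRightFKG → SAWTraversalBound` (`Negative.iff_imp`). -/
theorem sawTraversalBound_of_leftRightFKG (hPA : LeftRightFKG) : SAWTraversalBound :=
  FKGToTraversalBound_proof hPA

end Summit.CriticalPhenomena.SAWScalingLimit.Cruxes.FKGToTraversalBound.SlitNecklace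

end
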